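import Mathlib.LinearAlgebra.Complex.FiniteDimensional
import Literature.Analysis.Calculus.PoincareLemmaOneFormStarConvex
import Literature.Analysis.Complex.OsgoodProofs
import HarnessLib

/-!
# The Poincaré lemma for holomorphic `1`-forms on open star-shaped sets (holomorphic primitives)

Sibling of `PoincareLemmaOneFormStarConvex` (the REAL Poincaré lemma, Spivak's radial homotopy
formula, for `C¹` fields `A : E → E →L[ℝ] V` with symmetric derivative on an open star-shaped set).
Here `E` is a finite-dimensional COMPLEX normed space and `A : E → E →L[ℂ] V` is a field of
`ℂ`-linear maps — a `V`-valued holomorphic `1`-form `∑ Aᵢ dzⁱ` — which is complex differentiable and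
CLOSED: its complex derivative is symmetric, `DA(z)(v)(w) = DA(z)(w)(v)` (`∂Aᵢ/∂zⱼ = ∂Aⱼ/∂zᵢ`).  The
same radial integral

  `u(y) = ∫₀¹ A(z₀ + t (y - z₀)) (y - z₀) dt`

is then a HOLOMORPHIC primitive: `Du(z) = A(z)` as a `ℂ`-linear map, i.e. `u` is complex
differentiable with `∂u/∂zᵢ = Aᵢ` (and `∂u/∂z̄ᵢ = 0`).  Printed sources: L. Hörmander, *An Introduction to
Complex Analysis in Several Variables* (1973), §2.2 (holomorphic functions and forms on open subsets of
`ℂⁿ`; a `∂`-closed holomorphic `(1,0)`-form is `d`-closed) with the Poincaré lemma Thm. 2.1.? replaced by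
its elementary star-shaped case, Spivak, *Calculus on Manifolds* (1965), Thm. 4-11; the holomorphy of
the primitive is the remark that a real `C¹` function whose real differential is `ℂ`-linear at every
point is holomorphic (Cauchy–Riemann; Mathlib `hasFDerivAt_of_restrictScalars`).

* `hasFDerivAt_radialIntegral_of_starConvex_complex` — for `A` of class `C¹` over `ℂ` and closed on
  the open star-shaped `s`: `HasFDerivAt u (A z) z` over `ℂ` at every `z ∈ s`;
* `differentiableOn_radialIntegral_of_starConvex_complex` — hence `u` is holomorphic on `s`;
* `hasFDerivAt_radialIntegral_of_starConvex_of_differentiableOn` — the same with the hypothesis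
  «`A` complex differentiable on `s`» when `V` is finite-dimensional (Osgood's lemma,
  `Literature.Analysis.Complex.osgoodLemma_holds`: complex differentiable ⇒ analytic ⇒ `C¹`);
* `exists_differentiableOn_hasFDerivAt_of_fderiv_symm_of_starConvex_complex` — existence form.

Written as step S2 of the «analytic Albanese of a compact ball quotient» plan of the cell
`pub-hodgecm2` (holomorphic primitives on the ball `𝔹² ⊂ ℂ²` of lifted `(1,0)`-classes).
Everything is proved; no definition, no named fact.

## References

* [Spivak1965] M. Spivak, *Calculus on Manifolds* (1965), Thm. 4-11 and the operator `I` (p. 94).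
* [HormanderSCV1973] L. Hörmander, *An Introduction to Complex Analysis in Several Variables* (1973),
  §2.1–§2.2, Thm. 2.2.1.
* [LeeSmoothManifolds2013] J. M. Lee, *Introduction to Smooth Manifolds*, 2nd ed. (2013), Thm. 11.49.
-/

noncomputable section

open Set Metric MeasureTheory intervalIntegral Filter
open scoped Topology Interval

namespace Literature.Analysis.Calculus

variable {E : Type*} [NormedAddCommGroup E] [NormedSpace ℂ E] [FiniteDimensional ℂ E]
  {V : Type*} [NormedAddCommGroup V] [NormedSpace ℂ V] [CompleteSpace V]

omit [FiniteDimensional ℂ E] [CompleteSpace V] in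
/-- The real derivative of `z ↦ (A z).restrictScalars ℝ` is the restriction of scalars of the complex
derivative of `A`: `D_ℝ(A|_ℝ)(z)(v)(w) = D_ℂA(z)(v)(w)`. [folklore] -/
private theorem fderiv_restrictScalars_comp_apply {A : E → E →L[ℂ] V} {z : E} (hA : DifferentiableAt ℂ A z)
    (v w : E) :
    fderiv ℝ (fun y ↦ (A y).restrictScalars ℝ) z v w = fderiv ℂ A z v w := by
  set R : (E →L[ℂ] V) →L[ℝ] (E →L[ℝ] V) :=
    (ContinuousLinearMap.restrictScalarsIsometry ℂ E V ℝ ℝ).toContinuousLinearMap with hR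
  have hcomp : (fun y ↦ (A y).restrictScalars ℝ) = R ∘ A := by
    funext y; rfl
  have hAR : HasFDerivAt A ((fderiv ℂ A z).restrictScalars ℝ) z := hA.hasFDerivAt.restrictScalars ℝ
  have h : HasFDerivAt (R ∘ A) (R.comp ((fderiv ℂ A z).restrictScalars ℝ)) z :=
    R.hasFDerivAt.comp z hAR
  rw [hcomp, h.fderiv]
  rfl

/-- **The Poincaré lemma for holomorphic `1`-forms on an open star-shaped set.**  Let `E` be a
finite-dimensional complex normed space, `V` a complete complex normed space, and
`A : E → E →L[ℂ] V` a field of `ℂ`-linear maps of class `C¹` over `ℂ` on an open set `s` star-shaped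
with respect to `z₀`, CLOSED on `s` (`DA(z)(v)(w) = DA(z)(w)(v)`).  Then the radial integral
`u(y) = ∫₀¹ A(z₀ + t(y - z₀)) (y - z₀) dt` is a HOLOMORPHIC primitive: `Du(z) = A(z)` over `ℂ` at every
`z ∈ s`.  Proof: the real Poincaré lemma (`hasFDerivAt_radialIntegral_of_starConvex`) for the
restricted field `z ↦ (A z)|_ℝ` gives the real differential `A(z)|_ℝ`, which is `ℂ`-linear.
[cite: Spivak1965, Thm. 4-11] [cite: HormanderSCV1973, Thm 2.2.1 and §2.1] -/
theorem hasFDerivAt_radialIntegral_of_starConvex_complex {A : E → E →L[ℂ] V} {z₀ : E} {s : Set E}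
    (hso : IsOpen s) (hs : StarConvex ℝ z₀ s) (hA : ContDiffOn ℂ 1 A s)
    (hsymm : ∀ z ∈ s, ∀ v w : E, fderiv ℂ A z v w = fderiv ℂ A z w v)
    {z : E} (hz : z ∈ s) :
    HasFDerivAt (fun y ↦ ∫ t in (0 : ℝ)..1, A (z₀ + t • (y - z₀)) (y - z₀)) (A z) z := by
  haveI : FiniteDimensional ℝ E := FiniteDimensional.complexToReal E
  set R : (E →L[ℂ] V) →L[ℝ] (E →L[ℝ] V) :=
    (ContinuousLinearMap.restrictScalarsIsometry ℂ E V ℝ ℝ).toContinuousLinearMap with hR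
  set A' : E → E →L[ℝ] V := fun y ↦ (A y).restrictScalars ℝ with hA'def
  have hcomp : A' = R ∘ A := by funext y; rfl
  -- `A'` is `C¹` over `ℝ`
  have hA' : ContDiffOn ℝ 1 A' s := by
    rw [hcomp]
    exact R.contDiff.comp_contDiffOn (hA.restrict_scalars ℝ)
  -- `A'` is closed
  have hsymm' : ∀ y ∈ s, ∀ v w : E, fderiv ℝ A' y v w = fderiv ℝ A' y w v := by
    intro y hy v w
    have hAy : DifferentiableAt ℂ A y :=
      (hA.differentiableOn one_ne_zero y hy).differentiableAt (hso.mem_nhds hy)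
    rw [hA'def, fderiv_restrictScalars_comp_apply hAy, fderiv_restrictScalars_comp_apply hAy]
    exact hsymm y hy v w
  -- the real Poincaré lemma
  have hreal := hasFDerivAt_radialIntegral_of_starConvex hso hs hA' hsymm' hz
  -- the primitives coincide and the real differential `A'(z) = A(z)|_ℝ` is `ℂ`-linear
  exact hasFDerivAt_of_restrictScalars ℝ hreal rfl

/-- **The radial primitive of a closed holomorphic `1`-form is holomorphic** on the open star-shaped
set. [cite: Spivak1965, Thm. 4-11] [cite: HormanderSCV1973, Thm 2.2.1 and §2.1] -/
theorem differentiableOn_radialIntegral_of_starConvex_complex {A : E → E →L[ℂ] V} {z₀ : E}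
    {s : Set E} (hso : IsOpen s) (hs : StarConvex ℝ z₀ s) (hA : ContDiffOn ℂ 1 A s)
    (hsymm : ∀ z ∈ s, ∀ v w : E, fderiv ℂ A z v w = fderiv ℂ A z w v) :
    DifferentiableOn ℂ (fun y ↦ ∫ t in (0 : ℝ)..1, A (z₀ + t • (y - z₀)) (y - z₀)) s :=
  fun _ hz ↦ (hasFDerivAt_radialIntegral_of_starConvex_complex hso hs hA hsymm hz).differentiableAt
    |>.differentiableWithinAt

/-- **Existence form**: a closed `C¹`-holomorphic field `A : E → E →L[ℂ] V` on an open star-shaped set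
`s` is the complex differential of a holomorphic function on `s`.
[cite: Spivak1965, Thm. 4-11] [cite: HormanderSCV1973, Thm 2.2.1 and §2.1] -/
theorem exists_differentiableOn_hasFDerivAt_of_fderiv_symm_of_starConvex_complex
    {A : E → E →L[ℂ] V} {z₀ : E} {s : Set E} (hso : IsOpen s) (hs : StarConvex ℝ z₀ s)
    (hA : ContDiffOn ℂ 1 A s) (hsymm : ∀ z ∈ s, ∀ v w : E, fderiv ℂ A z v w = fderiv ℂ A z w v) :
    ∃ u : E → V, DifferentiableOn ℂ u s ∧ ∀ z ∈ s, HasFDerivAt u (A z) z :=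
  ⟨_, differentiableOn_radialIntegral_of_starConvex_complex hso hs hA hsymm,
    fun _ hz ↦ hasFDerivAt_radialIntegral_of_starConvex_complex hso hs hA hsymm hz⟩

/-- **Complex differentiable fields are `C¹`** (several complex variables, finite-dimensional values):
a field `A : E → E →L[ℂ] V`, `V` finite-dimensional, complex differentiable on an open set `s` is
analytic there — Osgood's lemma `Literature.Analysis.Complex.osgoodLemma_holds` applied to its
coordinates in a basis of the finite-dimensional space `E →L[ℂ] V` — hence of class `C^n` for every `n`.
[cite: HormanderSCV1973, Thm 2.2.1 and Thm 2.2.6] -/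
theorem contDiffOn_clm_of_differentiableOn [FiniteDimensional ℂ V] {A : E → E →L[ℂ] V} {s : Set E}
    (hso : IsOpen s) (hA : DifferentiableOn ℂ A s) {n : WithTop ℕ∞} : ContDiffOn ℂ n A s := by
  set e := (Module.finBasis ℂ (E →L[ℂ] V)).equivFun.toContinuousLinearEquiv with he
  have heA : DifferentiableOn ℂ (fun z ↦ e (A z)) s := e.differentiable.comp_differentiableOn hA
  have hcoord : ∀ i, AnalyticOnNhd ℂ (fun z ↦ e (A z) i) s := fun i ↦
    Literature.Analysis.Complex.osgoodLemma_holds E hso (differentiableOn_pi.1 heA i)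
  have hpi : AnalyticOnNhd ℂ (fun z ↦ e (A z)) s := by
    have h := (analyticOnNhd_pi_iff (𝕜 := ℂ) (f := fun i z ↦ e (A z) i) (s := s)).2 hcoord
    exact h
  have hA' : AnalyticOnNhd ℂ A s := by
    have h := (e.symm : _ →L[ℂ] (E →L[ℂ] V)).comp_analyticOnNhd hpi
    have heq : (⇑(e.symm : _ →L[ℂ] (E →L[ℂ] V))) ∘ (fun z ↦ e (A z)) = A := by
      funext z
      simp
    rwa [heq] at h
  exact hA'.contDiffOn_of_completeSpace

/-- **The Poincaré lemma for holomorphic `1`-forms, differentiability hypothesis** (`V`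
finite-dimensional, e.g. `V = ℂ`): a CLOSED complex differentiable field `A : E → E →L[ℂ] V` on an open
star-shaped set `s` has the radial integral as a holomorphic primitive, `Du(z) = A(z)` over `ℂ` on `s`.
[cite: Spivak1965, Thm. 4-11] [cite: HormanderSCV1973, Thm 2.2.1 and §2.1] -/
theorem hasFDerivAt_radialIntegral_of_starConvex_of_differentiableOn [FiniteDimensional ℂ V]
    {A : E → E →L[ℂ] V} {z₀ : E} {s : Set E} (hso : IsOpen s) (hs : StarConvex ℝ z₀ s)
    (hA : DifferentiableOn ℂ A s) (hsymm : ∀ z ∈ s, ∀ v w : E, fderiv ℂ A z v w = fderiv ℂ A z w v)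
    {z : E} (hz : z ∈ s) :
    HasFDerivAt (fun y ↦ ∫ t in (0 : ℝ)..1, A (z₀ + t • (y - z₀)) (y - z₀)) (A z) z :=
  hasFDerivAt_radialIntegral_of_starConvex_complex hso hs (contDiffOn_clm_of_differentiableOn hso hA)
    hsymm hz

/-- Holomorphy of the radial primitive under the differentiability hypothesis (`V` finite-dimensional).
[cite: Spivak1965, Thm. 4-11] [cite: HormanderSCV1973, Thm 2.2.1 and §2.1] -/
theorem differentiableOn_radialIntegral_of_starConvex_of_differentiableOn [FiniteDimensional ℂ V]
    {A : E → E →L[ℂ] V} {z₀ : E} {s : Set E} (hso : IsOpen s) (hs : StarConvex ℝ z₀ s)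
    (hA : DifferentiableOn ℂ A s) (hsymm : ∀ z ∈ s, ∀ v w : E, fderiv ℂ A z v w = fderiv ℂ A z w v) :
    DifferentiableOn ℂ (fun y ↦ ∫ t in (0 : ℝ)..1, A (z₀ + t • (y - z₀)) (y - z₀)) s :=
  differentiableOn_radialIntegral_of_starConvex_complex hso hs (contDiffOn_clm_of_differentiableOn hso hA)
    hsymm

end Literature.Analysis.Calculus

end
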